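import Literature.Computability.Complexity.CodeFPArith
import Literature.Probability.Distributions.PseudoGaussianSamplerCoins
import HarnessLib

/-!
# The pseudo-Gaussian sampler is polynomial time (typed `FP` on codes)

Family `quantum-advantage`, machine side of the discharge of Aaronson–Arkhipov's Thm. 1.3
(`gpeSolvableInFBPPRel_NPRel_of_approxBosonSamplingOracle`): the hiding step of that proof samples
the `m × n` decoy matrix entry by entry with the coin-driven sampler of
`Probability/Distributions/PseudoGaussianSampler*.lean`, on FLAT coin strings
(`PGParams.samplerFlat`, `PseudoGaussianSamplerCoins.lean`). This file proves that sampler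
polynomial-time computable in the typed sense of `CodeFP.lean` — as a function of a context record
carrying the sampler's parameters and of the coin block — by assembling it from the typed leaves of
`CodeFPArith.lean` (block values `strVal`, `strChunks`, integer arithmetic, `all`, folds); no machine
is written:

* `SamplerCtx` — the parameter record `(hdrLen, k, Mmax, J, attLen ; T, 2ᵏ, 4ᵇ)` (five unary, three
  binary fields), its code `samplerCtxE`, and `PGParams.ctx`;
* `magOf`, `accBlocks`, `mOf`, `okOf`, `attemptOf`, `samplerOf` — the sampler written against the
  record, with `attemptOf_ctx`/`samplerOf_ctx`: at the record of `P` they are `P.attemptFlat`,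
  `P.samplerFlat` (the acceptance test enumerates the `Mmax` blocks, which covers `i < M(|j|)` because
  `M(|j|) < Mmax` on the range);
* **`samplerOf_codeFP : CodeFP (pairE samplerCtxE strE) intE (fun p => samplerOf p.1 p.2)`**.

## References

* S. Aaronson, A. Arkhipov, *The computational complexity of linear optics*, Theory of Computing 9
  (2013) 143–252, §5.2 (proof of Thm. 1.3; p. 195, the hiding procedure in `BPP`).
* S. Arora, B. Barak, *Computational Complexity: A Modern Approach*, CUP 2009, §1.3 (closure of
  polynomial time under composition and bounded loops).
-/

namespace Literature.Computability.QuantumComplexity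

open Literature.Computability.Complexity Literature.Computability.Complexity.CodeFP
  Literature.Probability.Distributions

/-! ### The parameter record -/

/-- The sampler's parameters as a record: `(hdrLen, k, Mmax, J, attLen, T, 2ᵏ, 4ᵇ)`. [folklore] -/
abbrev SamplerCtx : Type := ℕ × ℕ × ℕ × ℕ × ℕ × ℕ × ℕ × ℕ

/-- The code of the record: the five loop bounds in unary, the three arithmetic constants in binary.
[folklore] -/
abbrev samplerCtxE : SamplerCtx → List Bool :=
  pairE unE (pairE unE (pairE unE (pairE unE (pairE unE (pairE natE (pairE natE natE))))))

namespace SamplerCtx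

variable (c : SamplerCtx)

/-- Header length. [folklore] -/
abbrev hdr : ℕ := c.1
/-- Acceptance block length `k`. [folklore] -/
abbrev kk : ℕ := c.2.1
/-- Number of acceptance blocks. [folklore] -/
abbrev mmax : ℕ := c.2.2.1
/-- Number of attempts. [folklore] -/
abbrev jj : ℕ := c.2.2.2.1
/-- Attempt block length. [folklore] -/
abbrev att : ℕ := c.2.2.2.2.1
/-- `T`. [folklore] -/
abbrev tt : ℕ := c.2.2.2.2.2.1
/-- `2ᵏ`. [folklore] -/
abbrev pk : ℕ := c.2.2.2.2.2.2.1
/-- `4ᵇ`. [folklore] -/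
abbrev fb : ℕ := c.2.2.2.2.2.2.2

end SamplerCtx

/-- The record of a parameter set. [folklore] -/
def _root_.Literature.Probability.Distributions.PGParams.ctx (P : PGParams) : SamplerCtx :=
  (P.hdrLen, P.k, P.Mmax, P.J, P.attLen, P.T, 2 ^ P.k, 4 ^ P.b)

/-! ### The sampler against the record -/

/-- Magnitude value of an attempt block. [folklore] -/
def magOf (c : SamplerCtx) (w : List Bool) : ℕ := bitsToNat (w.take c.hdr)

/-- The `Mmax` acceptance blocks of an attempt block. [folklore] -/
def accBlocks (c : SamplerCtx) (w : List Bool) : List (List Bool) :=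
  (List.range c.mmax).map fun i => ((w.drop c.hdr).drop (i * c.kk)).take c.kk

/-- The number `M(|j|) = ⌊|j|² 2ᵏ / 4ᵇ⌋` of blocks to test. [folklore] -/
def mOf (c : SamplerCtx) (w : List Bool) : ℕ :=
  ((magOf c w : ℤ) - c.tt).natAbs * ((magOf c w : ℤ) - c.tt).natAbs * c.pk / c.fb

/-- The test of one enumerated block `(i, block)` against the threshold `M`: `i ≥ M` or the block is
nonzero. [folklore] -/
def okTest (q : ℕ × ℕ × List Bool) : Bool := decide (q.1 ≤ q.2.1) || !decide (bitsToNat q.2.2 = 0)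

/-- The acceptance test: every enumerated block of index `< M` is nonzero. [folklore] -/
def okOf (c : SamplerCtx) (w : List Bool) : Bool :=
  ((List.range (accBlocks c w).length).zip (accBlocks c w)).all fun a => okTest (mOf c w, a)

/-- The attempt against the record. [folklore] -/
def attemptOf (c : SamplerCtx) (w : List Bool) : Bool × ℤ :=
  if decide (magOf c w = 0) then (false, 0)
  else if okOf c w then (true, (magOf c w : ℤ) - c.tt) else (false, 0)

/-- The sampler against the record. [folklore] -/
def samplerOf (c : SamplerCtx) (w : List Bool) : ℤ :=
  (((List.range c.jj).map fun t => attemptOf c ((w.drop (t * c.att)).take c.att)).foldl pick (false, 0)).2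

/-! ### Agreement with `PGParams.attemptFlat` / `samplerFlat` -/

/-- The enumerated test is the bounded quantifier when `M ≤ Mmax`. [folklore] -/
theorem all_zip_range_iff {M : ℕ} (L : List (List Bool)) (hM : M ≤ L.length) :
    (((List.range L.length).zip L).all fun a => okTest (M, a)) = true ↔
      ∀ i < M, bitsToNat (L.getD i []) ≠ 0 := by
  simp only [okTest]
  rw [List.all_eq_true]
  constructor
  · intro h i hi hz
    have hiL : i < L.length := lt_of_lt_of_le hi hM
    have hmem : (i, L[i]) ∈ (List.range L.length).zip L := by
      rw [List.mem_iff_getElem]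
      refine ⟨i, by simp [hiL], ?_⟩
      simp
    have := h _ hmem
    simp only [Bool.or_eq_true, decide_eq_true_eq, Bool.not_eq_true', decide_eq_false_iff_not] at this
    rcases this with h1 | h1
    · omega
    · rw [List.getD_eq_getElem _ _ hiL] at hz; exact h1 hz
  · intro h q hq
    obtain ⟨i, hi, hq'⟩ := List.mem_iff_getElem.1 hq
    simp only [List.length_zip, List.length_range, min_self] at hi
    simp only [List.getElem_zip, List.getElem_range] at hq'
    subst hq'
    simp only [Bool.or_eq_true, decide_eq_true_eq, Bool.not_eq_true', decide_eq_false_iff_not]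
    by_cases hiM : M ≤ i
    · exact Or.inl hiM
    · right
      have := h i (by omega)
      rwa [List.getD_eq_getElem _ _ hi] at this

/-- At the record of `P`, the acceptance test is that of `attemptFlat`. [folklore] -/
theorem okOf_ctx (P : PGParams) (w : List Bool) (h0 : P.magVal w ≠ 0) :
    okOf P.ctx w = true ↔ ∀ i < P.M (((P.magVal w : ℕ) : ℤ) - P.T).natAbs, P.accVal w i ≠ 0 := by
  have hM : P.M (((P.magVal w : ℕ) : ℤ) - P.T).natAbs < P.Mmax :=
    P.M_lt_Mmax (P.natAbs_sub_T_lt (P.magVal_lt w) h0)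
  have hlen : (accBlocks P.ctx w).length = P.Mmax := by simp [accBlocks, PGParams.ctx]
  have hm : mOf P.ctx w = P.M (((P.magVal w : ℕ) : ℤ) - P.T).natAbs := by
    rw [PGParams.M, pow_two]; rfl
  rw [okOf, hm, all_zip_range_iff _ (by rw [hlen]; exact hM.le)]
  refine forall₂_congr fun i hi => ?_
  have hiM : i < P.Mmax := hi.trans hM
  rw [List.getD_eq_getElem _ _ (by rw [hlen]; exact hiM)]
  simp [accBlocks, PGParams.ctx, PGParams.accVal, PGParams.accBlock, List.getElem_map]

/-- **At the record of `P`, `attemptOf` is `attemptFlat`.** [folklore] -/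
theorem attemptOf_ctx (P : PGParams) (w : List Bool) : attemptOf P.ctx w = P.attemptFlat w := by
  have hmag : magOf P.ctx w = P.magVal w := rfl
  unfold attemptOf PGParams.attemptFlat
  rw [hmag]
  by_cases h0 : P.magVal w = 0
  · simp [h0]
  · rw [if_neg (by simpa using h0), if_neg h0]
    by_cases hok : ∀ i < P.M (((P.magVal w : ℕ) : ℤ) - P.T).natAbs, P.accVal w i ≠ 0
    · rw [if_pos ((okOf_ctx P w h0).2 hok), if_pos hok]; rfl
    · rw [if_neg hok, if_neg (fun h => hok ((okOf_ctx P w h0).1 h))]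

/-- **At the record of `P`, `samplerOf` is `samplerFlat`.** [folklore] -/
theorem samplerOf_ctx (P : PGParams) (w : List Bool) : samplerOf P.ctx w = P.samplerFlat w := by
  unfold samplerOf PGParams.samplerFlat
  simp only [attemptOf_ctx]
  rfl

/-! ### Typed polynomial time -/

section Codes

/-- The argument code `⟨record, block⟩`. [folklore] -/
abbrev samplerArgE : SamplerCtx × List Bool → List Bool := pairE samplerCtxE strE

/-- A field projection of the argument is typed polynomial time. [folklore] -/
theorem SamplerCtx.ctx_fst : CodeFP samplerArgE samplerCtxE (fun p => p.1) := fst _ _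
/-- A field projection of the argument is typed polynomial time. [folklore] -/
theorem SamplerCtx.hdr_codeFP : CodeFP samplerArgE unE (fun p => p.1.hdr) := (fst _ _).fst'
/-- A field projection of the argument is typed polynomial time. [folklore] -/
theorem SamplerCtx.kk_codeFP : CodeFP samplerArgE unE (fun p => p.1.kk) := (fst _ _).snd'.fst'
/-- A field projection of the argument is typed polynomial time. [folklore] -/
theorem SamplerCtx.mmax_codeFP : CodeFP samplerArgE unE (fun p => p.1.mmax) := (fst _ _).snd'.snd'.fst'
/-- A field projection of the argument is typed polynomial time. [folklore] -/
theorem SamplerCtx.jj_codeFP : CodeFP samplerArgE unE (fun p => p.1.jj) := (fst _ _).snd'.snd'.snd'.fst'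
/-- A field projection of the argument is typed polynomial time. [folklore] -/
theorem SamplerCtx.att_codeFP : CodeFP samplerArgE unE (fun p => p.1.att) := (fst _ _).snd'.snd'.snd'.snd'.fst'
/-- A field projection of the argument is typed polynomial time. [folklore] -/
theorem SamplerCtx.tt_codeFP : CodeFP samplerArgE natE (fun p => p.1.tt) :=
  (fst _ _).snd'.snd'.snd'.snd'.snd'.fst'
/-- A field projection of the argument is typed polynomial time. [folklore] -/
theorem SamplerCtx.pk_codeFP : CodeFP samplerArgE natE (fun p => p.1.pk) :=
  (fst _ _).snd'.snd'.snd'.snd'.snd'.snd'.fst'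
/-- A field projection of the argument is typed polynomial time. [folklore] -/
theorem SamplerCtx.fb_codeFP : CodeFP samplerArgE natE (fun p => p.1.fb) :=
  (fst _ _).snd'.snd'.snd'.snd'.snd'.snd'.snd'
/-- A field projection of the argument is typed polynomial time. [folklore] -/
theorem SamplerCtx.w_codeFP : CodeFP samplerArgE strE (fun p => p.2) := snd _ _

/-- `magOf` is typed polynomial time. [folklore] -/
theorem magOf_codeFP : CodeFP samplerArgE natE (fun p => magOf p.1 p.2) := by
  exact (strVal.comp (strTake.comp (SamplerCtx.hdr_codeFP.pair SamplerCtx.w_codeFP)) :)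

/-- `accBlocks` is typed polynomial time. [folklore] -/
theorem accBlocks_codeFP : CodeFP samplerArgE (rawE strE) (fun p => accBlocks p.1 p.2) := by
  exact (strChunks.comp (SamplerCtx.mmax_codeFP.pair (SamplerCtx.kk_codeFP.pair (strDrop.comp (SamplerCtx.hdr_codeFP.pair SamplerCtx.w_codeFP)))) :)

/-- The proposed value `v - T` is typed polynomial time. [folklore] -/
theorem valOf_codeFP : CodeFP samplerArgE intE (fun p => (magOf p.1 p.2 : ℤ) - p.1.tt) := by
  exact (intSub.comp ((intOfNat.comp magOf_codeFP).pair (intOfNat.comp SamplerCtx.tt_codeFP)) :)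

/-- `mOf` is typed polynomial time. [folklore] -/
theorem mOf_codeFP : CodeFP samplerArgE natE (fun p => mOf p.1 p.2) := by
  have ha : CodeFP samplerArgE natE (fun p => ((magOf p.1 p.2 : ℤ) - p.1.tt).natAbs) := by
    exact (intNatAbs.comp valOf_codeFP :)
  have h2 : CodeFP samplerArgE natE
      (fun p => ((magOf p.1 p.2 : ℤ) - p.1.tt).natAbs * ((magOf p.1 p.2 : ℤ) - p.1.tt).natAbs) := by
    exact (natMul.comp (ha.pair ha) :)
  have h3 : CodeFP samplerArgE natE
      (fun p => ((magOf p.1 p.2 : ℤ) - p.1.tt).natAbs * ((magOf p.1 p.2 : ℤ) - p.1.tt).natAbs * p.1.pk) := by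
    exact (natMul.comp (h2.pair SamplerCtx.pk_codeFP) :)
  exact (natDiv.comp (h3.pair SamplerCtx.fb_codeFP) :)

/-- `okTest` is typed polynomial time. [folklore] -/
theorem okTest_codeFP : CodeFP (pairE natE (pairE natE strE)) bitE okTest := by
  have h1 : CodeFP (pairE natE (pairE natE strE)) bitE (fun q => decide (q.1 ≤ q.2.1)) := by
    exact (natLe.comp ((fst _ _).pair (snd _ _).fst') :)
  have h2 : CodeFP (pairE natE (pairE natE strE)) bitE (fun q => decide (bitsToNat q.2.2 = 0)) := by
    exact (natEq.comp ((strVal.comp (snd _ _).snd').pair (const _ 0)) :)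
  exact (h1.or h2.not :)

/-- `okOf` is typed polynomial time. [folklore] -/
theorem okOf_codeFP : CodeFP samplerArgE bitE (fun p => okOf p.1 p.2) := by
  have he : CodeFP samplerArgE (rawE (pairE natE strE))
      (fun p => (List.range (accBlocks p.1 p.2).length).zip (accBlocks p.1 p.2)) := by
    exact ((rawEnum strE).comp accBlocks_codeFP :)
  exact ((all (σ := ℕ) (α := ℕ × List Bool) (p := okTest) okTest_codeFP).comp (mOf_codeFP.pair he) :)

/-- `attemptOf` is typed polynomial time. [folklore] -/
theorem attemptOf_codeFP : CodeFP samplerArgE (pairE bitE intE) (fun p => attemptOf p.1 p.2) := by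
  have h0 : CodeFP samplerArgE bitE (fun p => decide (magOf p.1 p.2 = 0)) := by
    exact (natEq.comp (magOf_codeFP.pair (const _ 0)) :)
  have hval : CodeFP samplerArgE (pairE bitE intE) (fun p => (true, (magOf p.1 p.2 : ℤ) - p.1.tt)) := by
    exact ((const _ true).pair valOf_codeFP :)
  have hnone : CodeFP samplerArgE (pairE bitE intE) (fun _ => ((false, 0) : Bool × ℤ)) := const _ _
  have hin : CodeFP samplerArgE (pairE bitE intE)
      (fun p => if okOf p.1 p.2 then (true, (magOf p.1 p.2 : ℤ) - p.1.tt) else (false, 0)) := by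
    exact (okOf_codeFP.ite hval hnone :)
  exact (h0.ite hnone hin :)

/-- The `pick`-fold's value is the start or an item. [folklore] -/
theorem foldl_pick_mem : ∀ (l : List (Bool × ℤ)) (st : Bool × ℤ), l.foldl pick st ∈ st :: l
  | [], st => by simp
  | a :: l, st => by
    rw [List.foldl_cons]
    by_cases hs : st.1 = true
    · have hp : pick st a = st := by simp [pick, hs]
      rw [hp]
      rcases List.mem_cons.1 (foldl_pick_mem l st) with h | h
      · rw [h]; exact List.mem_cons_self
      · exact List.mem_cons_of_mem _ (List.mem_cons_of_mem _ h)
    · have hp : pick st a = a := by simp [pick, hs]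
      rw [hp]
      exact List.mem_cons_of_mem _ (foldl_pick_mem l a)

/-- The step of the `pick`-fold on `(item, accumulator)`. [folklore] -/
def pickStep (t : (Bool × ℤ) × (Bool × ℤ)) : Bool × ℤ := if t.2.1 then t.2 else t.1

/-- `pickStep` is `pick`. [folklore] -/
theorem pickStep_eq (o st : Bool × ℤ) : pickStep (o, st) = pick st o := rfl

/-- `pickStep` is typed polynomial time. [folklore] -/
theorem pickStep_codeFP : CodeFP (pairE (pairE bitE intE) (pairE bitE intE)) (pairE bitE intE) pickStep := by
  exact (((snd _ _).fst').ite (snd _ _) (fst _ _) :)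

/-- The `pick`-fold over a raw list of pairs is typed polynomial time. [folklore] -/
theorem foldl_pick_codeFP :
    CodeFP (rawE (pairE bitE intE)) (pairE bitE intE) (fun l => l.foldl pick (false, 0)) := by
  have h := foldl₀ (eα := pairE bitE intE) (eβ := pairE bitE intE) (step := fun o st => pickStep (o, st))
    (b₀ := (false, 0)) pickStep_codeFP (Polynomial.X + 8) fun l₁ l₂ => ?_
  · exact h
  · change (pairE bitE intE (l₁.foldl pick (false, 0))).length ≤ _
    have hmem := foldl_pick_mem l₁ (false, 0)
    rw [Polynomial.eval_add, Polynomial.eval_X]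
    rcases List.mem_cons.1 hmem with h | h
    · rw [h]
      simp [pairE, bitE, intE, Brick.dpEnc]
    · have := length_item_le_length_rawE (pairE bitE intE) (List.mem_append_left l₂ h)
      simp only [Polynomial.eval_ofNat]
      omega

/-- **The pseudo-Gaussian sampler is typed polynomial time** in the record and the coin block.
[cite: AaronsonArkhipovToC2013, §5.2 (proof of Thm. 1.3)] -/
theorem samplerOf_codeFP : CodeFP samplerArgE intE (fun p => samplerOf p.1 p.2) := by
  -- the attempt blocks
  have hblocks : CodeFP samplerArgE (rawE strE)
      (fun p => (List.range p.1.jj).map fun t => (p.2.drop (t * p.1.att)).take p.1.att) := by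
    exact (strChunks.comp (SamplerCtx.jj_codeFP.pair (SamplerCtx.att_codeFP.pair SamplerCtx.w_codeFP)) :)
  -- map the attempt with the record as context
  have hmap : CodeFP samplerArgE (rawE (pairE bitE intE))
      (fun p => ((List.range p.1.jj).map fun t => (p.2.drop (t * p.1.att)).take p.1.att).map
        fun blk => attemptOf p.1 blk) := by
    exact ((map (σ := SamplerCtx) (α := List Bool) (g := fun q => attemptOf q.1 q.2) attemptOf_codeFP).comp
      (SamplerCtx.ctx_fst.pair hblocks) :)
  have hfold : CodeFP samplerArgE (pairE bitE intE)
      (fun p => (((List.range p.1.jj).map fun t => (p.2.drop (t * p.1.att)).take p.1.att).map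
        fun blk => attemptOf p.1 blk).foldl pick (false, 0)) := by
    exact (foldl_pick_codeFP.comp hmap :)
  refine hfold.snd'.congr fun p => ?_
  simp only [samplerOf, List.map_map]
  rfl

end Codes

end Literature.Computability.QuantumComplexity
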